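import Summits.KontsevichZagierPeriods.KontsevichZagierPeriods.Theorems.HurwitzMicroSectorsNormalFormPrincipleM2ExistsLogMonomialRep
import Summits.KontsevichZagierPeriods.KontsevichZagierPeriods.Theorems.HurwitzMicroSectorsNormalFormPrincipleM2IntegrableLogs
import Summits.KontsevichZagierPeriods.KontsevichZagierPeriods.Theorems.HurwitzMicroSectorsNormalFormPrincipleM2BoxQuadSubLogMonomial
import Summits.KontsevichZagierPeriods.KontsevichZagierPeriods.Theorems.HurwitzMicroSectorsNormalFormPrincipleM2LogMonomialMulInstances
import Summits.KontsevichZagierPeriods.KontsevichZagierPeriods.Theorems.HurwitzMicroSectorsNormalFormPrincipleM2LogMonomialDilate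
import Summits.KontsevichZagierPeriods.KontsevichZagierPeriods.Theorems.HurwitzMicroSectorsNormalFormPrincipleM2LogMonomialInvSubZetaBand
import Summits.KontsevichZagierPeriods.KontsevichZagierPeriods.Theorems.HurwitzMicroSectorsNormalFormPrincipleM2BookkeepingKit

/-!
# `NormalFormPrinciple` (stmt-KontsevichZagierPeriods-3869), line `SketchIdeator1` — the leaf
# `stub_boxRigidity` in dimension two OFF THE PRODUCT TYPE: `FiveZetaTwoOffProduct`

Composition (lead seat c8) of the seven registered sub-goal stubs of the layer (all landed:
`exists_logMonomialRep`, `integrable_logs`, `boxQuad_sub_logMonomial`, `logMonomial_mul_instances`,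
`logMonomial_dilate`, `logMonomialInv_sub_zetaBand`, `bookkeeping_kit`): the box representations
`[(0,1)², 12/(1 + x² + xy)]` and `[(0,1)², 5/(1 − xy)]` — both of value `5ζ(2)`
(`∫∫ dxdy/(1+x²+xy) = 5π²/72`), the first genuinely two-variable — are KZ-equivalent. This is the
strategist's by-product P3 of crux idea `m2-equal-value-instances` (gen-1 census, N8 lattice
experiment): an instance of Conjecture 1 of Kontsevich–Zagier in dimension two, off the product
type, that needs NO transcendence input — only moves.

The chain uses rules 1a, 1b, 2 only. Write `M(g, v) = [{0 < x < 1, 1 ≤ s ≤ v(x)}, g(x)/s]`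
(the unfolded log monomial, value `∫₀¹ g log v`). Then
* `[band-box, 1/(1+x²+xy)] ≡ W := M(1/x, (1+x+x²)/(1+x²))` (affine `s = 1 + xy/(1+x²)`, rule 2);
* product rule (rules 1a + 2): `A ≡ B + W`, `L ≡ A + M₃`, `L ≡ P + M₂`, where `A = M(1/x, 1+x+x²)`,
  `B = M(1/x, 1+x²)`, `L = M(1/x, 1/(1−x))`, `P = M(1/x, 1+x)`, `M_k = M(1/x, 1/(1−xᵏ))`;
* dilations `u = xᵏ` (rule 2): `M₃ ≡ M(1/(3u), 1/(1−u))`, `M₂ ≡ M(1/(2u), 1/(1−u))`,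
  `B ≡ M(1/(2u), 1+u)`, and `n • M(c/(nu), v) ≡ M(c/u, v)` (rule 1b);
* hence `3A ≡ 2L`, `2P ≡ L`, `4B ≡ L` and `12 W ≡ 8L − 3L = 5L`;
* `L ≡ [band-box, 1/(1−xy)]` (fibre substitution + reflection, rule 2), and the open boxes differ
  from the band-boxes by two null edges (rule 1a).
References: M. Kontsevich, D. Zagier, *Periods* (2001), §1.2 (rules (1), (2), Conjecture 1).
No definitions are introduced.
-/

noncomputable section

open MeasureTheory Set
open Literature.NumberTheory.Transcendental Literature.NumberTheory.Transcendental.KZ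
open Literature.ModelTheory.ExponentialFields (IsSemialgebraic)

namespace Summit.KontsevichZagierPeriods.HurwitzMicroSectors.NormalFormPrinciple.PiBox.M2

/-! ## Semialgebraicity of the weights and edges on the base `(0,1) ⊆ ℝ¹` -/

/-- The weight `1/((n)x)` (`n ≠ 0`) is `ℚ`-semialgebraic on `(0,1)`. [folklore] -/
theorem isSemialgebraicFunOn_one_div_natMul {n : ℕ} (hn : n ≠ 0) :
    IsSemialgebraicFunOn ℚ {y : Fin 1 → ℝ | 0 < y 0 ∧ y 0 < 1}
      (fun y => (fun x : ℝ => 1 / ((n : ℝ) * x)) (y 0)) := by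
  refine (isSemialgebraicFunOn_aeval_div_aeval isSemialgebraic_unitInterval_fin_one 1
    (MvPolynomial.C (n : ℚ) * MvPolynomial.X 0) fun y hy => ?_).congr fun y _ => by simp
  have h1 : (n : ℝ) ≠ 0 := Nat.cast_ne_zero.2 hn
  simpa [h1] using hy.1.ne'

/-- The weight `1/x` is `ℚ`-semialgebraic on `(0,1)`. [folklore] -/
theorem isSemialgebraicFunOn_one_div :
    IsSemialgebraicFunOn ℚ {y : Fin 1 → ℝ | 0 < y 0 ∧ y 0 < 1}
      (fun y => (fun x : ℝ => 1 / x) (y 0)) := by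
  refine (isSemialgebraicFunOn_aeval_div_aeval isSemialgebraic_unitInterval_fin_one 1
    (MvPolynomial.X 0) fun y hy => ?_).congr fun y _ => by simp
  simpa using hy.1.ne'

/-- The edge `1/(1 − x)` is `ℚ`-semialgebraic on `(0,1)`. [folklore] -/
theorem isSemialgebraicFunOn_one_div_one_sub :
    IsSemialgebraicFunOn ℚ {y : Fin 1 → ℝ | 0 < y 0 ∧ y 0 < 1}
      (fun y => (fun x : ℝ => 1 / (1 - x)) (y 0)) := by
  refine (isSemialgebraicFunOn_aeval_div_aeval isSemialgebraic_unitInterval_fin_one 1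
    (1 - MvPolynomial.X 0) fun y hy => ?_).congr fun y _ => by simp
  simpa using (sub_pos.2 hy.2).ne'

/-! ## The composition -/

/-- **`FiveZetaTwoOffProduct`** (strategist's P3, crux idea `m2-equal-value-instances`): the box
representations `[(0,1)², 12/(1 + x² + xy)]` and `[(0,1)², 5/(1 − xy)]` — both of value `5ζ(2)`,
the first genuinely two-variable (off the product type) — are KZ-equivalent; an instance of the
leaf `stub_boxRigidity` (Conjecture 1 of Kontsevich–Zagier for box-rational representations) in
dimension two needing no transcendence input, by moves of rules (1a), (1b), (2) only.
[cite: KontsevichZagier2001, §1.2 Conjecture 1] -/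
theorem fiveZetaTwoOffProduct (N N' : IntegralRep 2)
    (hNd : N.domain = {x | ∀ i, x i ∈ Set.Ioo (0:ℝ) 1})
    (hNi : EqOn N.integrand (fun x => 12 / (1 + x 0 ^ 2 + x 0 * x 1)) N.domain)
    (hN'd : N'.domain = {x | ∀ i, x i ∈ Set.Ioo (0:ℝ) 1})
    (hN'i : EqOn N'.integrand (fun x => 5 / (1 - x 0 * x 1)) N'.domain) :
    Equivalent N N' := by
  have hG : IsSemialgebraic ℚ {y : Fin 1 → ℝ | 0 < y 0 ∧ y 0 < 1} :=
    isSemialgebraic_unitInterval_fin_one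
  obtain ⟨hIP, hIB, hIA, hIW, hIinv⟩ := integrable_logs
  obtain ⟨hnsmul, hboxband, ⟨T, hTd, hTi⟩, ⟨Z, hZd, hZi⟩⟩ := bookkeeping_kit
  obtain ⟨hmulA, hmulP, hmulW⟩ := logMonomial_mul_instances
  -- ### semialgebraicity of the edges
  have hvA : IsSemialgebraicFunOn ℚ {y : Fin 1 → ℝ | 0 < y 0 ∧ y 0 < 1}
      (fun y => (fun x : ℝ => 1 + x + x ^ 2) (y 0)) :=
    (isSemialgebraicFunOn_aeval hG (1 + MvPolynomial.X 0 + MvPolynomial.X 0 ^ 2)).congr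
      fun y _ => by simp
  have hvB : IsSemialgebraicFunOn ℚ {y : Fin 1 → ℝ | 0 < y 0 ∧ y 0 < 1}
      (fun y => (fun x : ℝ => 1 + x ^ 2) (y 0)) :=
    (isSemialgebraicFunOn_aeval hG (1 + MvPolynomial.X 0 ^ 2)).congr fun y _ => by simp
  have hvP : IsSemialgebraicFunOn ℚ {y : Fin 1 → ℝ | 0 < y 0 ∧ y 0 < 1}
      (fun y => (fun x : ℝ => 1 + x) (y 0)) :=
    (isSemialgebraicFunOn_aeval hG (1 + MvPolynomial.X 0)).congr fun y _ => by simp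
  have hvW : IsSemialgebraicFunOn ℚ {y : Fin 1 → ℝ | 0 < y 0 ∧ y 0 < 1}
      (fun y => (fun x : ℝ => (1 + x + x ^ 2) / (1 + x ^ 2)) (y 0)) := by
    refine (isSemialgebraicFunOn_aeval_div_aeval hG (1 + MvPolynomial.X 0 + MvPolynomial.X 0 ^ 2)
      (1 + MvPolynomial.X 0 ^ 2) fun y _ => ?_).congr fun y _ => by simp
    have : (0:ℝ) < 1 + y 0 ^ 2 := by positivity
    simpa using this.ne'
  have hvM : ∀ (k : ℕ), 1 ≤ k → IsSemialgebraicFunOn ℚ {y : Fin 1 → ℝ | 0 < y 0 ∧ y 0 < 1}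
      (fun y => (fun x : ℝ => 1 / (1 - x ^ k)) (y 0)) := fun k hk => by
    refine (isSemialgebraicFunOn_aeval_div_aeval hG 1 (1 - MvPolynomial.X 0 ^ k)
      fun y hy => ?_).congr fun y _ => by simp
    have h1 : y 0 ^ k < 1 := pow_lt_one₀ hy.1.le hy.2 (by omega)
    simpa using (sub_pos.2 h1).ne'
  -- ### lower bounds `v ≥ 1` on `(0,1)`
  have h1A : ∀ x ∈ Set.Ioo (0:ℝ) 1, 1 ≤ (fun x : ℝ => 1 + x + x ^ 2) x := fun x hx => by
    simp only; nlinarith [hx.1, sq_nonneg x]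
  have h1B : ∀ x ∈ Set.Ioo (0:ℝ) 1, 1 ≤ (fun x : ℝ => 1 + x ^ 2) x := fun x hx => by
    simp only; nlinarith [sq_nonneg x]
  have h1P : ∀ x ∈ Set.Ioo (0:ℝ) 1, 1 ≤ (fun x : ℝ => 1 + x) x := fun x hx => by
    simp only; linarith [hx.1]
  have h1W : ∀ x ∈ Set.Ioo (0:ℝ) 1, 1 ≤ (fun x : ℝ => (1 + x + x ^ 2) / (1 + x ^ 2)) x :=
    fun x hx => by
    simp only
    rw [le_div_iff₀ (by positivity)]
    nlinarith [hx.1]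
  have h1M : ∀ (k : ℕ), 1 ≤ k → ∀ x ∈ Set.Ioo (0:ℝ) 1, 1 ≤ (fun x : ℝ => 1 / (1 - x ^ k)) x :=
    fun k hk x hx => by
    simp only
    have hxk : x ^ k < 1 := pow_lt_one₀ hx.1.le hx.2 (by omega)
    have hxk0 : 0 ≤ x ^ k := pow_nonneg hx.1.le k
    rw [le_div_iff₀ (sub_pos.2 hxk)]
    linarith
  have h1L : ∀ x ∈ Set.Ioo (0:ℝ) 1, 1 ≤ (fun x : ℝ => 1 / (1 - x)) x := fun x hx => by
    simpa using h1M 1 le_rfl x hx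
  -- ### integrability of the weighted logarithms (from the kit)
  have hIL : IntegrableOn (fun x : ℝ => (fun x : ℝ => 1 / x) x *
      Real.log ((fun x : ℝ => 1 / (1 - x)) x)) (Set.Ioo (0:ℝ) 1) := by
    simpa using hIinv 1 1 le_rfl
  have hIM3 : IntegrableOn (fun x : ℝ => (fun x : ℝ => 1 / x) x *
      Real.log ((fun x : ℝ => 1 / (1 - x ^ 3)) x)) (Set.Ioo (0:ℝ) 1) := by
    simpa using hIinv 1 3 (by norm_num)
  have hIM2 : IntegrableOn (fun x : ℝ => (fun x : ℝ => 1 / x) x *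
      Real.log ((fun x : ℝ => 1 / (1 - x ^ 2)) x)) (Set.Ioo (0:ℝ) 1) := by
    simpa using hIinv 1 2 (by norm_num)
  have hIM3' : IntegrableOn (fun x : ℝ => (fun x : ℝ => 1 / (((2 + 1 : ℕ) : ℝ) * x)) x *
      Real.log ((fun x : ℝ => 1 / (1 - x)) x)) (Set.Ioo (0:ℝ) 1) := by
    have h := hIinv (1 / 3) 1 le_rfl
    refine h.congr_fun (fun x _ => ?_) measurableSet_Ioo
    simp only [pow_one]
    push_cast
    ring
  have hIM2' : IntegrableOn (fun x : ℝ => (fun x : ℝ => 1 / (((1 + 1 : ℕ) : ℝ) * x)) x *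
      Real.log ((fun x : ℝ => 1 / (1 - x)) x)) (Set.Ioo (0:ℝ) 1) := by
    have h := hIinv (1 / 2) 1 le_rfl
    refine h.congr_fun (fun x _ => ?_) measurableSet_Ioo
    simp only [pow_one]
    push_cast
    ring
  have hIB' : IntegrableOn (fun x : ℝ => (fun x : ℝ => 1 / (((1 + 1 : ℕ) : ℝ) * x)) x *
      Real.log ((fun x : ℝ => 1 + x) x)) (Set.Ioo (0:ℝ) 1) := by
    have h : IntegrableOn (fun x : ℝ => 1 / 2 * ((1 / x) * Real.log (1 + x))) (Set.Ioo (0:ℝ) 1) :=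
      hIP.const_mul (1 / 2)
    refine h.congr_fun (fun x _ => ?_) measurableSet_Ioo
    push_cast
    ring
  -- ### the representations of the chain
  obtain ⟨W, hWd, hWi⟩ := exists_logMonomialRep _ _ isSemialgebraicFunOn_one_div hvW h1W hIW
  obtain ⟨A, hAd, hAi⟩ := exists_logMonomialRep _ _ isSemialgebraicFunOn_one_div hvA h1A hIA
  obtain ⟨B, hBd, hBi⟩ := exists_logMonomialRep _ _ isSemialgebraicFunOn_one_div hvB h1B hIB
  obtain ⟨P, hPd, hPi⟩ := exists_logMonomialRep _ _ isSemialgebraicFunOn_one_div hvP h1P hIP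
  obtain ⟨L, hLd, hLi⟩ := exists_logMonomialRep _ _ isSemialgebraicFunOn_one_div
    isSemialgebraicFunOn_one_div_one_sub h1L hIL
  obtain ⟨M₃, hM3d, hM3i⟩ := exists_logMonomialRep _ _ isSemialgebraicFunOn_one_div
    (hvM 3 (by norm_num)) (h1M 3 (by norm_num)) hIM3
  obtain ⟨M₂, hM2d, hM2i⟩ := exists_logMonomialRep _ _ isSemialgebraicFunOn_one_div
    (hvM 2 (by norm_num)) (h1M 2 (by norm_num)) hIM2
  obtain ⟨M₃', hM3'd, hM3'i⟩ := exists_logMonomialRep _ _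
    (isSemialgebraicFunOn_one_div_natMul (n := 2 + 1) (by norm_num))
    isSemialgebraicFunOn_one_div_one_sub h1L hIM3'
  obtain ⟨M₂', hM2'd, hM2'i⟩ := exists_logMonomialRep _ _
    (isSemialgebraicFunOn_one_div_natMul (n := 1 + 1) (by norm_num))
    isSemialgebraicFunOn_one_div_one_sub h1L hIM2'
  obtain ⟨B', hB'd, hB'i⟩ := exists_logMonomialRep _ _
    (isSemialgebraicFunOn_one_div_natMul (n := 1 + 1) (by norm_num)) hvP h1P hIB'
  -- ### membership bookkeeping on the bands
  have memL : ∀ {z : Fin 2 → ℝ}, z ∈ L.domain → 0 < z 0 ∧ 1 ≤ z 1 := fun {z} hz => by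
    rw [hLd] at hz
    exact ⟨hz.1.1, hz.2.1⟩
  have memP : ∀ {z : Fin 2 → ℝ}, z ∈ P.domain → 0 < z 0 ∧ 1 ≤ z 1 := fun {z} hz => by
    rw [hPd] at hz
    exact ⟨hz.1.1, hz.2.1⟩
  -- ### the relations
  -- (rule 2) affine unfolding of the quadratic box
  have e1 : of T - of W ∈ relations :=
    boxQuad_sub_logMonomial T W hTd (hTi ▸ fun _ _ => rfl) hWd (hWi ▸ fun _ _ => rfl)
  -- product rule instances
  have e2 : of A - of B - of W ∈ relations :=
    hmulW A B W hAd (hAi ▸ fun _ _ => rfl) hBd (hBi ▸ fun _ _ => rfl) hWd (hWi ▸ fun _ _ => rfl)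
  have e3 : of L - of A - of M₃ ∈ relations :=
    hmulA L A M₃ hLd (hLi ▸ fun _ _ => rfl) hAd (hAi ▸ fun _ _ => rfl) hM3d (hM3i ▸ fun _ _ => rfl)
  have e4 : of L - of P - of M₂ ∈ relations :=
    hmulP L P M₂ hLd (hLi ▸ fun _ _ => rfl) hPd (hPi ▸ fun _ _ => rfl) hM2d (hM2i ▸ fun _ _ => rfl)
  -- dilations `u = x³`, `u = x²`
  have e5 : of M₃ - of M₃' ∈ relations :=
    logMonomial_dilate 2 1 (fun u => 1 / (1 - u)) M₃ M₃' hM3d (hM3i ▸ fun _ _ => rfl) hM3'd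
      (hM3'i ▸ fun _ _ => rfl)
  have e7 : of M₂ - of M₂' ∈ relations :=
    logMonomial_dilate 1 1 (fun u => 1 / (1 - u)) M₂ M₂' hM2d (hM2i ▸ fun _ _ => rfl) hM2'd
      (hM2'i ▸ fun _ _ => rfl)
  have e9 : of B - of B' ∈ relations :=
    logMonomial_dilate 1 1 (fun u => 1 + u) B B' hBd (hBi ▸ fun _ _ => rfl) hB'd
      (hB'i ▸ fun _ _ => rfl)
  -- integer multiples inside the weights
  have e6 : of L - 3 • of M₃' ∈ relations := by
    refine hnsmul 3 L M₃' (hM3'd.trans hLd.symm) fun z hz => ?_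
    obtain ⟨h0, h1⟩ := memL hz
    rw [hLi, hM3'i]
    push_cast
    field_simp
  have e8 : of L - 2 • of M₂' ∈ relations := by
    refine hnsmul 2 L M₂' (hM2'd.trans hLd.symm) fun z hz => ?_
    obtain ⟨h0, h1⟩ := memL hz
    rw [hLi, hM2'i]
    push_cast
    field_simp
  have e10 : of P - 2 • of B' ∈ relations := by
    refine hnsmul 2 P B' (hB'd.trans hPd.symm) fun z hz => ?_
    obtain ⟨h0, h1⟩ := memP hz
    rw [hPi, hB'i]
    push_cast
    field_simp
  -- the ζ(2) block
  have e11 : of L - of Z ∈ relations :=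
    logMonomialInv_sub_zetaBand L Z hLd (hLi ▸ fun _ _ => rfl) hZd (hZi ▸ fun _ _ => rfl)
  -- open boxes versus band-boxes
  have e12 : of N - 12 • of T ∈ relations := by
    refine hboxband 12 (fun x => 1 / (1 + x 0 ^ 2 + x 0 * x 1)) N T hNd (fun x hx => ?_) hTd
      (hTi ▸ fun _ _ => rfl)
    rw [hNi hx]
    push_cast
    ring
  have e13 : of N' - 5 • of Z ∈ relations := by
    refine hboxband 5 (fun x => 1 / (1 - x 0 * x 1)) N' Z hN'd (fun x hx => ?_) hZd
      (hZi ▸ fun _ _ => rfl)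
    rw [hN'i hx]
    push_cast
    ring
  -- ### linear algebra in `FormalRep`
  have acc : (of N - 12 • of T) + 12 • (of T - of W) + 5 • (of L - of Z) - (of N' - 5 • of Z)
        - 12 • (of A - of B - of W) - 12 • (of L - of A - of M₃) + 6 • (of L - of P - of M₂)
        - 12 • (of M₃ - of M₃') + 4 • (of L - 3 • of M₃') + 6 • (of M₂ - of M₂')
        - 3 • (of L - 2 • of M₂') - 12 • (of B - of B') + 6 • (of P - 2 • of B') ∈ relations := by
    refine relations.add_mem (relations.sub_mem (relations.sub_mem (relations.add_mem
      (relations.add_mem (relations.sub_mem (relations.add_mem (relations.sub_mem (relations.sub_mem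
      (relations.sub_mem (relations.add_mem (relations.add_mem e12 (relations.nsmul_mem e1 12))
      (relations.nsmul_mem e11 5)) e13) (relations.nsmul_mem e2 12)) (relations.nsmul_mem e3 12))
      (relations.nsmul_mem e4 6)) (relations.nsmul_mem e5 12)) (relations.nsmul_mem e6 4))
      (relations.nsmul_mem e7 6)) (relations.nsmul_mem e8 3)) (relations.nsmul_mem e9 12))
      (relations.nsmul_mem e10 6)
  have key : of N - of N' =
      (of N - 12 • of T) + 12 • (of T - of W) + 5 • (of L - of Z) - (of N' - 5 • of Z)
        - 12 • (of A - of B - of W) - 12 • (of L - of A - of M₃) + 6 • (of L - of P - of M₂)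
        - 12 • (of M₃ - of M₃') + 4 • (of L - 3 • of M₃') + 6 • (of M₂ - of M₂')
        - 3 • (of L - 2 • of M₂') - 12 • (of B - of B') + 6 • (of P - 2 • of B') := by
    abel
  unfold Equivalent
  rw [key]
  exact acc

end Summit.KontsevichZagierPeriods.HurwitzMicroSectors.NormalFormPrinciple.PiBox.M2
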